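import Mathlib
import Literature.NumberTheory.LFunctions.Zhang2022.SkeletonPartThree
import Literature.NumberTheory.LFunctions.Zhang2022.SkeletonPartOneC
import HarnessLib

/-!
# Zhang (2022) §18, proof of (2.33): the majorant `n⁻¹∏_{q∣n}(1+c/q)` and `|λ₀ⱼ(n)|/φ(n)`

Topic `Literature/NumberTheory/LFunctions/Zhang2022` (Landau–Siegel audit tree; verdict-neutral).
Y. Zhang, *Discrete mean estimates and the Landau–Siegel zero*, arXiv:2211.02515v1 (2022)
[Zhang2022LandauSiegel], §18 pp. 99–100 (tex L4914–L4955), "Proof of (2.33)" — an unrefereed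
manuscript under adjudication (campaign D-0069, discharge layer L4, cone leaf C27 `Skeleton.Ded183`,
DAG nodes `Z22:(2.33).pf`, `Z22:§18.u010`–`u012`). The block applies Proposition 7.1 at
`𝐚₁ = 𝐚₂ = 𝐚₂₃`, whose error term `O(E)`, `E = 𝔓𝓛²Σ_j|S_j(𝐚₂₃,𝐚₂₃)|`, needs the TWO-SIDED size of
`S_j`; the printed crude bound (u013) is one-sided, but the displayed range evaluations (u010–u012)
are two-sided with EXPLICIT main terms `(500L′(1,χ)/log P)² Σ_n |χ(n)|λ₀ⱼ(n)/φ(n)·(…)(…)`. This file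
proves, unconditionally and from the definitions only, that sums of that shape are `O_{c′}(𝓛⁻⁵)`:

* `sum_prod_one_add_div_le` — `Σ_{1≤n≤X} n⁻¹∏_{q∣n}(1 + c/q) ≤ eᶜ(1 + log X)` (`c ≥ 0`; expand over
  subsets of the prime factors, harmonic bound along multiples, `∏_{q≤X}(1+c/q²) ≤ eᶜ`);
* `norm_lamZero_div_totient_le` — `|λ₀ⱼ(n)|/φ(n) ≤ n⁻¹∏_{q∣n}(1 + 25/q)` (`λ₀ⱼ(n) = λ(n, 1−β_j)` of
  §7: every `β` is purely imaginary, so each local factor has norm `≤ (1+1/q)³/(1−1/q)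
  ≤ (1+25/q)(1−1/q)`, and `φ(n) = n∏(1−1/q)`);
* `betaJ_re`, `norm_betaJ_le` — every `β_j` is purely imaginary, `|β_j| ≤ 3α(1 + 5|c′|α𝓛)`.

The companion `Section18SjNormSizes` turns these into the eventual bound
`‖(500L′/log P)² Σ_{n∈F} |χ(n)|λ₀ⱼ(n)/φ(n)·A(n)B(n)‖ ≪_{c′} 𝓛⁻⁵` for the §18 main terms
(`TypedSection18.main18u010/main18u011`), which discharges the implicit error-term input of
`Sec18Ded183.ded183_of_steps`. Everything here is PROVED from the
skeleton's definitions (`Skeleton.lamZero`, `betaJ`, `fraky1`, `Nsupp`, `bigP`, `ell`, `alpha`);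
no claim of the manuscript is asserted, no named fact is used, nothing bears on Theorems 1–2.

## References

* Y. Zhang, arXiv:2211.02515v1 (2022), §18 p. 100; §7 p. 34 (`λ`); §10 (10.9) (`𝒴₁ⱼ`); §2 (2.6),
  (2.10), (2.13). [cite: Zhang2022LandauSiegel, §18 p.100]
-/

noncomputable section

open Complex Real Finset

namespace Literature.NumberTheory.LFunctions.Zhang2022.Sec18SjNorm


/-- The harmonic bound along the multiples of `d ≥ 1`: `Σ_{1 ≤ n ≤ X, d ∣ n} 1/n ≤ (1 + log X)/d`.
[folklore] -/
private theorem sum_inv_filter_dvd_le {d : ℕ} (hd : 0 < d) (X : ℕ) :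
    ∑ n ∈ (Icc 1 X).filter (fun n => d ∣ n), (n : ℝ)⁻¹ ≤ (1 + Real.log X) / d := by
  -- the multiples of `d` in `[1, X]` are among `d·m`, `m ∈ [1, X]`
  have hsub : (Icc 1 X).filter (fun n => d ∣ n) ⊆ (Icc 1 X).image (fun m => d * m) := by
    intro n hn
    rw [mem_filter, mem_Icc] at hn
    obtain ⟨⟨h1, hX⟩, ⟨m, rfl⟩⟩ := hn
    rw [mem_image]
    refine ⟨m, mem_Icc.mpr ⟨?_, ?_⟩, rfl⟩
    · rcases Nat.eq_zero_or_pos m with h0 | h0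
      · simp [h0] at h1
      · exact h0
    · exact le_trans (Nat.le_mul_of_pos_left m hd) hX
  have hinj : Set.InjOn (fun m => d * m) ((Icc 1 X : Finset ℕ) : Set ℕ) := by
    intro a _ b _ hab
    exact Nat.eq_of_mul_eq_mul_left hd hab
  have hharm : ∑ m ∈ Icc 1 X, ((m : ℕ) : ℝ)⁻¹ ≤ 1 + Real.log X := by
    rcases Nat.eq_zero_or_pos X with rfl | hX
    · simp
    · have h := harmonic_le_one_add_log X
      rw [harmonic_eq_sum_Icc] at h
      push_cast at h
      exact h
  calc ∑ n ∈ (Icc 1 X).filter (fun n => d ∣ n), (n : ℝ)⁻¹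
      ≤ ∑ n ∈ (Icc 1 X).image (fun m => d * m), (n : ℝ)⁻¹ :=
        sum_le_sum_of_subset_of_nonneg hsub fun n _ _ => by positivity
    _ = ∑ m ∈ Icc 1 X, ((d * m : ℕ) : ℝ)⁻¹ := sum_image hinj
    _ = (d : ℝ)⁻¹ * ∑ m ∈ Icc 1 X, ((m : ℕ) : ℝ)⁻¹ := by
        rw [mul_sum]
        refine sum_congr rfl fun m _ => ?_
        push_cast
        rw [mul_inv]
    _ ≤ (d : ℝ)⁻¹ * (1 + Real.log X) := by gcongr
    _ = (1 + Real.log X) / d := by rw [div_eq_inv_mul]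

/-- `Σ_{q ≤ X prime} 1/q² ≤ 1` (from `Σ_{i ≥ 2} 1/i² ≤ 1`, Mathlib's `sum_Ioo_inv_sq_le`). [folklore] -/
private theorem sum_primes_inv_sq_le_one (X : ℕ) :
    ∑ q ∈ (range (X + 1)).filter Nat.Prime, ((q : ℝ) ^ 2)⁻¹ ≤ 1 := by
  have hsub : (range (X + 1)).filter Nat.Prime ⊆ Ioo 1 (X + 1) := by
    intro q hq
    rw [mem_filter, mem_range] at hq
    exact mem_Ioo.mpr ⟨hq.2.one_lt, hq.1⟩
  calc ∑ q ∈ (range (X + 1)).filter Nat.Prime, ((q : ℝ) ^ 2)⁻¹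
      ≤ ∑ q ∈ Ioo 1 (X + 1), ((q : ℝ) ^ 2)⁻¹ :=
        sum_le_sum_of_subset_of_nonneg hsub fun q _ _ => by positivity
    _ ≤ 2 / (1 + 1) := by exact_mod_cast sum_Ioo_inv_sq_le (α := ℝ) 1 (X + 1)
    _ = 1 := by norm_num

/-- **`Σ_{1≤n≤X} n⁻¹ ∏_{q∣n}(1 + c/q) ≤ eᶜ(1 + log X)`** for `c ≥ 0` (the product over the prime
factors `q` of `n`) — the elementary mean-value bound behind the size `(500L′/log P)²Σ|χ(n)λ₀ⱼ(n)|/φ(n)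
≪ 𝓛⁻⁵` of the §18 main terms (p.100). [cite: Zhang2022LandauSiegel, §18 p.100] -/
theorem sum_prod_one_add_div_le {c : ℝ} (hc : 0 ≤ c) (X : ℕ) :
    ∑ n ∈ Icc 1 X, (∏ q ∈ n.primeFactors, (1 + c / (q : ℝ))) / (n : ℝ) ≤
      Real.exp c * (1 + Real.log X) := by
  classical
  -- the primes `≤ X`
  set P : Finset ℕ := (range (X + 1)).filter Nat.Prime with hP
  have hlogX : 0 ≤ 1 + Real.log X := by
    have : 0 ≤ Real.log X := Real.log_natCast_nonneg X
    linarith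
  -- Step 1–2: expand the product over subsets of the prime factors
  have hexp : ∀ n : ℕ, (∏ q ∈ n.primeFactors, (1 + c / (q : ℝ))) / (n : ℝ) =
      ∑ T ∈ n.primeFactors.powerset, (∏ q ∈ T, (c / (q : ℝ))) / (n : ℝ) := by
    intro n
    rw [prod_one_add, sum_div]
  rw [sum_congr rfl fun n _ => hexp n]
  -- Step 3: swap the sums
  have hswap : ∑ n ∈ Icc 1 X, ∑ T ∈ n.primeFactors.powerset, (∏ q ∈ T, (c / (q : ℝ))) / (n : ℝ) =
      ∑ T ∈ P.powerset, ∑ n ∈ (Icc 1 X).filter (fun n => T ⊆ n.primeFactors),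
        (∏ q ∈ T, (c / (q : ℝ))) / (n : ℝ) := by
    refine sum_comm' fun n T => ?_
    simp only [mem_powerset, mem_filter, mem_Icc]
    constructor
    · rintro ⟨⟨h1, hX⟩, hT⟩
      refine ⟨⟨⟨h1, hX⟩, hT⟩, hT.trans fun q hq => ?_⟩
      rw [hP, mem_filter, mem_range]
      have hq' := Nat.mem_primeFactors.mp hq
      exact ⟨Nat.lt_succ_of_le (le_trans (Nat.le_of_dvd h1 hq'.2.1) hX), hq'.1⟩
    · rintro ⟨⟨⟨h1, hX⟩, hT⟩, _⟩
      exact ⟨⟨h1, hX⟩, hT⟩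
  rw [hswap]
  -- Step 4: the inner sums
  have hinner : ∀ T ∈ P.powerset,
      ∑ n ∈ (Icc 1 X).filter (fun n => T ⊆ n.primeFactors), (∏ q ∈ T, (c / (q : ℝ))) / (n : ℝ) ≤
        (∏ q ∈ T, (c / (q : ℝ) ^ 2)) * (1 + Real.log X) := by
    intro T hT
    rw [mem_powerset] at hT
    have hTprime : ∀ q ∈ T, q.Prime := fun q hq => by
      have := hT hq
      rw [hP, mem_filter] at this
      exact this.2
    set d : ℕ := ∏ q ∈ T, q with hd
    have hdpos : 0 < d := prod_pos fun q hq => (hTprime q hq).pos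
    have hcT : 0 ≤ ∏ q ∈ T, (c / (q : ℝ)) := prod_nonneg fun q _ => by positivity
    -- `T ⊆ primeFactors n ⇒ d ∣ n`
    have hsub : (Icc 1 X).filter (fun n => T ⊆ n.primeFactors) ⊆ (Icc 1 X).filter (fun n => d ∣ n) := by
      intro n hn
      rw [mem_filter] at hn ⊢
      refine ⟨hn.1, ?_⟩
      rw [hd]
      exact Finset.prod_primes_dvd n (fun q hq => (hTprime q hq).prime)
        fun q hq => (Nat.mem_primeFactors.mp (hn.2 hq)).2.1
    have hdR : (d : ℝ) = ∏ q ∈ T, (q : ℝ) := by rw [hd]; push_cast; rfl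
    calc ∑ n ∈ (Icc 1 X).filter (fun n => T ⊆ n.primeFactors), (∏ q ∈ T, (c / (q : ℝ))) / (n : ℝ)
        = (∏ q ∈ T, (c / (q : ℝ))) *
            ∑ n ∈ (Icc 1 X).filter (fun n => T ⊆ n.primeFactors), (n : ℝ)⁻¹ := by
          rw [mul_sum]
          refine sum_congr rfl fun n _ => ?_
          rw [div_eq_mul_inv]
      _ ≤ (∏ q ∈ T, (c / (q : ℝ))) * ∑ n ∈ (Icc 1 X).filter (fun n => d ∣ n), (n : ℝ)⁻¹ :=
          mul_le_mul_of_nonneg_left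
            (sum_le_sum_of_subset_of_nonneg hsub fun n _ _ => by positivity) hcT
      _ ≤ (∏ q ∈ T, (c / (q : ℝ))) * ((1 + Real.log X) / d) := by
          gcongr
          exact sum_inv_filter_dvd_le hdpos X
      _ = (∏ q ∈ T, (c / (q : ℝ))) / (∏ q ∈ T, (q : ℝ)) * (1 + Real.log X) := by
          rw [hdR]; ring
      _ = (∏ q ∈ T, (c / (q : ℝ) ^ 2)) * (1 + Real.log X) := by
          rw [← prod_div_distrib]
          congr 1
          refine prod_congr rfl fun q _ => ?_
          rw [div_div, sq]
  -- Step 5–6: re-fold and bound the Euler-type product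
  have hprimes : ∀ q ∈ P, 0 ≤ c / (q : ℝ) ^ 2 := fun q _ => by positivity
  calc ∑ T ∈ P.powerset, ∑ n ∈ (Icc 1 X).filter (fun n => T ⊆ n.primeFactors),
          (∏ q ∈ T, (c / (q : ℝ))) / (n : ℝ)
      ≤ ∑ T ∈ P.powerset, (∏ q ∈ T, (c / (q : ℝ) ^ 2)) * (1 + Real.log X) := sum_le_sum hinner
    _ = (∏ q ∈ P, (1 + c / (q : ℝ) ^ 2)) * (1 + Real.log X) := by
        rw [← sum_mul, prod_one_add]
    _ ≤ Real.exp (∑ q ∈ P, c / (q : ℝ) ^ 2) * (1 + Real.log X) := by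
        gcongr
        exact Real.prod_one_add_le_exp_sum P fun q => by positivity
    _ ≤ Real.exp c * (1 + Real.log X) := by
        gcongr
        calc ∑ q ∈ P, c / (q : ℝ) ^ 2 = c * ∑ q ∈ P, ((q : ℝ) ^ 2)⁻¹ := by
              rw [mul_sum]
              refine sum_congr rfl fun q _ => ?_
              rw [div_eq_mul_inv]
          _ ≤ c * 1 := by gcongr; exact sum_primes_inv_sq_le_one X
          _ = c := mul_one c


open Skeleton

section Beta

variable (c' : ℝ) (D : ℕ)

/-- `β₁, β₂, β₃` are purely imaginary ((2.13)), hence so is every `β_j`. [cite: Zhang2022LandauSiegel, §2 (2.13)] -/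
theorem betaJ_re (j : ℕ) : (betaJ c' D j).re = 0 := by
  unfold betaJ beta1 beta2 beta3
  split_ifs <;> simp [Complex.mul_re, Complex.mul_im]

/-- `|β_j| ≤ 3α(1 + 5|c′|α𝓛)` for every `j` ((2.13): `β₁ = iα(1−5c′α𝓛)`, `β₂ = 2iα(1+c′α𝓛)`,
`β₃ = 3iα(1−c′α𝓛)`), for `D ≥ 3`. [cite: Zhang2022LandauSiegel, §2 (2.13)] -/
theorem norm_betaJ_le (hD : 3 ≤ D) (j : ℕ) :
    ‖betaJ c' D j‖ ≤ 3 * alpha D * (1 + 5 * |c'| * alpha D * ell D) := by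
  have hα : 0 < alpha D := alpha_pos hD
  have hℓ : 0 < ell D := lt_trans one_pos (one_lt_ell hD)
  have hx : 0 ≤ |c'| * alpha D * ell D := by positivity
  have key : ∀ (k : ℝ) (t : ℝ), 0 ≤ k → k ≤ 3 → |t| ≤ 5 * |c'| * alpha D * ell D →
      ‖(k : ℂ) * I * (alpha D : ℂ) * ((1 + t : ℝ) : ℂ)‖ ≤ 3 * alpha D * (1 + 5 * |c'| * alpha D * ell D) := by
    intro k t hk0 hk3 ht
    rw [norm_mul, norm_mul, norm_mul, Complex.norm_I, mul_one, Complex.norm_real, Complex.norm_real,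
      Complex.norm_real, Real.norm_of_nonneg hk0, Real.norm_of_nonneg hα.le, Real.norm_eq_abs]
    have h1 : |1 + t| ≤ 1 + 5 * |c'| * alpha D * ell D := by
      calc |1 + t| ≤ |1| + |t| := abs_add_le _ _
        _ ≤ 1 + 5 * |c'| * alpha D * ell D := by rw [abs_one]; linarith
    exact mul_le_mul (mul_le_mul_of_nonneg_right hk3 hα.le) h1 (abs_nonneg _) (by positivity)
  unfold betaJ
  split_ifs with h1 h2
  · -- β₁ = iα(1 − 5c′α𝓛)
    have e : beta1 c' D = ((1 : ℝ) : ℂ) * I * (alpha D : ℂ) * ((1 + (-(5 * c' * alpha D * ell D)) : ℝ) : ℂ) := by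
      rw [beta1]; push_cast; ring
    rw [e]
    refine key 1 _ (by norm_num) (by norm_num) ?_
    rw [abs_neg, abs_mul, abs_mul, abs_mul, abs_of_pos hα, abs_of_pos hℓ]
    norm_num
  · -- β₂ = 2iα(1 + c′α𝓛)
    have e : beta2 c' D = ((2 : ℝ) : ℂ) * I * (alpha D : ℂ) * ((1 + c' * alpha D * ell D : ℝ) : ℂ) := by
      rw [beta2]; push_cast; ring
    rw [e]
    refine key 2 _ (by norm_num) (by norm_num) ?_
    rw [abs_mul, abs_mul, abs_of_pos hα, abs_of_pos hℓ]
    nlinarith [abs_nonneg c']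
  · -- β₃ = 3iα(1 − c′α𝓛)
    have e : beta3 c' D = ((3 : ℝ) : ℂ) * I * (alpha D : ℂ) * ((1 + (-(c' * alpha D * ell D)) : ℝ) : ℂ) := by
      rw [beta3]; push_cast; ring
    rw [e]
    refine key 3 _ (by norm_num) le_rfl ?_
    rw [abs_neg, abs_mul, abs_mul, abs_of_pos hα, abs_of_pos hℓ]
    nlinarith [abs_nonneg c']

end Beta

section Lambda

variable (c' : ℝ) (D : ℕ)

/-- The elementary inequality behind the `λ₀ⱼ`-majorant: `(1+x)³ ≤ (1+25x)(1−x)²` on `[0, 1/2]`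
(`(1+25x)(1−x)² − (1+x)³ = 4x(1−2x)(5−3x)`). [folklore] -/
private theorem one_add_pow_three_le {x : ℝ} (h0 : 0 ≤ x) (h1 : x ≤ 1 / 2) :
    (1 + x) ^ 3 ≤ (1 + 25 * x) * (1 - x) ^ 2 := by
  nlinarith [mul_nonneg (mul_nonneg h0 (by linarith : (0:ℝ) ≤ 1 - 2 * x)) (by linarith : (0:ℝ) ≤ 5 - 3 * x)]

/-- `‖q^{−w}‖ = 1/q` for a prime (indeed any positive) `q` and `Re w = 1`. [folklore] -/
private theorem norm_natCast_cpow_neg_of_re_eq_one {q : ℕ} (hq : 0 < q) {w : ℂ} (hw : w.re = 1) :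
    ‖(q : ℂ) ^ (-w)‖ = 1 / q := by
  rw [Complex.norm_natCast_cpow_of_pos hq, Complex.neg_re, hw, Real.rpow_neg_one, one_div]

/-- **The local factor of `λ(n, 1−β_j)`**: for a prime `q`,
`‖(1−q^{−(s+β₁)})(1−q^{−(s+β₂)})(1−q^{−(s+β₃)})/(1−q^{−s})‖ ≤ (1 + 25/q)(1 − 1/q)` at `s = 1 − β_j`
(`Re s = Re(s + β_k) = 1`, so each factor has norm in `[1 − 1/q, 1 + 1/q]`, and
`(1+1/q)³/(1−1/q) ≤ (1+25/q)(1−1/q)`). [cite: Zhang2022LandauSiegel, §7 p.34 (the definition of `λ`)] -/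
theorem norm_lam_factor_le {q : ℕ} (hq : q.Prime) (j : ℕ) :
    ‖(1 - (q : ℂ) ^ (-(1 - betaJ c' D j + beta1 c' D))) * (1 - (q : ℂ) ^ (-(1 - betaJ c' D j + beta2 c' D))) *
        (1 - (q : ℂ) ^ (-(1 - betaJ c' D j + beta3 c' D))) / (1 - (q : ℂ) ^ (-(1 - betaJ c' D j)))‖ ≤
      (1 + 25 / (q : ℝ)) * (1 - 1 / (q : ℝ)) := by
  have hq0 : 0 < q := hq.pos
  have hq2 : (2 : ℝ) ≤ q := by exact_mod_cast hq.two_le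
  have hqR : (0 : ℝ) < q := by exact_mod_cast hq0
  set x : ℝ := 1 / (q : ℝ) with hx
  have hx0 : 0 ≤ x := by positivity
  have hx1 : x ≤ 1 / 2 := by
    rw [hx, div_le_div_iff₀ hqR (by norm_num)]; linarith
  have hre : (1 - betaJ c' D j).re = 1 := by simp [betaJ_re]
  have hre1 : (1 - betaJ c' D j + beta1 c' D).re = 1 := by
    rw [Complex.add_re, hre]; have := betaJ_re c' D 1; simp [betaJ] at this; simp [this]
  have hre2 : (1 - betaJ c' D j + beta2 c' D).re = 1 := by
    rw [Complex.add_re, hre]; have := betaJ_re c' D 2; simp [betaJ] at this; simp [this]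
  have hre3 : (1 - betaJ c' D j + beta3 c' D).re = 1 := by
    rw [Complex.add_re, hre]; have := betaJ_re c' D 3; simp [betaJ] at this; simp [this]
  -- each numerator factor has norm `≤ 1 + x`, the denominator `≥ 1 − x > 0`
  have hnum : ∀ {w : ℂ}, w.re = 1 → ‖1 - (q : ℂ) ^ (-w)‖ ≤ 1 + x := by
    intro w hw
    calc ‖1 - (q : ℂ) ^ (-w)‖ ≤ ‖(1 : ℂ)‖ + ‖(q : ℂ) ^ (-w)‖ := norm_sub_le _ _
      _ = 1 + x := by rw [norm_one, norm_natCast_cpow_neg_of_re_eq_one hq0 hw]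
  have hden : 1 - x ≤ ‖1 - (q : ℂ) ^ (-(1 - betaJ c' D j))‖ := by
    calc 1 - x = ‖(1 : ℂ)‖ - ‖(q : ℂ) ^ (-(1 - betaJ c' D j))‖ := by
          rw [norm_one, norm_natCast_cpow_neg_of_re_eq_one hq0 hre]
      _ ≤ ‖1 - (q : ℂ) ^ (-(1 - betaJ c' D j))‖ := norm_sub_norm_le _ _
  have hden0 : 0 < 1 - x := by linarith
  rw [norm_div, norm_mul, norm_mul]
  rw [div_le_iff₀ (lt_of_lt_of_le hden0 hden)]
  calc ‖1 - (q : ℂ) ^ (-(1 - betaJ c' D j + beta1 c' D))‖ *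
        ‖1 - (q : ℂ) ^ (-(1 - betaJ c' D j + beta2 c' D))‖ *
        ‖1 - (q : ℂ) ^ (-(1 - betaJ c' D j + beta3 c' D))‖
      ≤ (1 + x) * (1 + x) * (1 + x) := by
        have := hnum hre1; have := hnum hre2; have := hnum hre3
        gcongr
    _ = (1 + x) ^ 3 := by ring
    _ ≤ (1 + 25 * x) * (1 - x) ^ 2 := one_add_pow_three_le hx0 hx1
    _ = (1 + 25 * x) * (1 - x) * (1 - x) := by ring
    _ ≤ (1 + 25 * x) * (1 - x) * ‖1 - (q : ℂ) ^ (-(1 - betaJ c' D j))‖ := by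
        have h25 : 0 ≤ (1 + 25 * x) * (1 - x) := by positivity
        exact mul_le_mul_of_nonneg_left hden h25
    _ = (1 + 25 / (q : ℝ)) * (1 - 1 / (q : ℝ)) * ‖1 - (q : ℂ) ^ (-(1 - betaJ c' D j))‖ := by
        rw [hx]; ring

/-- **`|λ₀ⱼ(n)| ≤ (φ(n)/n) ∏_{q∣n}(1 + 25/q)`** for `n ≥ 1` (`λ₀ⱼ(n) = λ(n, 1−β_j)`, §7 p.34), by
`norm_lam_factor_le` and Euler's `φ(n) = n∏_{q∣n}(1 − 1/q)`. [cite: Zhang2022LandauSiegel, §7 p.34] -/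
theorem norm_lamZero_le (j : ℕ) {n : ℕ} (hn : n ≠ 0) :
    ‖lamZero c' D j n‖ ≤ (∏ q ∈ n.primeFactors, (1 + 25 / (q : ℝ))) * ((Nat.totient n : ℝ) / n) := by
  have hnR : (0 : ℝ) < n := by exact_mod_cast Nat.pos_of_ne_zero hn
  have hφ : (Nat.totient n : ℝ) / n = ∏ q ∈ n.primeFactors, (1 - 1 / (q : ℝ)) := by
    rw [MertensBound.totient_eq_mul_prod_one_sub_inv, mul_div_cancel_left₀ _ hnR.ne']
  rw [hφ, ← prod_mul_distrib, lamZero, lam, norm_prod]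
  refine prod_le_prod (fun q _ => norm_nonneg _) fun q hq => ?_
  have hqp : q.Prime := (Nat.mem_primeFactors.mp hq).1
  convert norm_lam_factor_le c' D hqp j using 3

/-- **`|λ₀ⱼ(n)|/φ(n) ≤ n⁻¹∏_{q∣n}(1 + 25/q)`** for `n ≥ 1`. [cite: Zhang2022LandauSiegel, §7 p.34] -/
theorem norm_lamZero_div_totient_le (j : ℕ) {n : ℕ} (hn : n ≠ 0) :
    ‖lamZero c' D j n‖ / (Nat.totient n : ℝ) ≤ (∏ q ∈ n.primeFactors, (1 + 25 / (q : ℝ))) / n := by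
  have hnR : (0 : ℝ) < n := by exact_mod_cast Nat.pos_of_ne_zero hn
  have hφ : (0 : ℝ) < Nat.totient n := by exact_mod_cast Nat.totient_pos.mpr (Nat.pos_of_ne_zero hn)
  rw [div_le_div_iff₀ hφ hnR]
  calc ‖lamZero c' D j n‖ * n ≤ (∏ q ∈ n.primeFactors, (1 + 25 / (q : ℝ))) * ((Nat.totient n : ℝ) / n) * n :=
        mul_le_mul_of_nonneg_right (norm_lamZero_le c' D j hn) hnR.le
    _ = (∏ q ∈ n.primeFactors, (1 + 25 / (q : ℝ))) * (Nat.totient n : ℝ) := by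
        field_simp

end Lambda

end Literature.NumberTheory.LFunctions.Zhang2022.Sec18SjNorm
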